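import Summits.Ventures.LatticeQCDFlow.Scaling.ReplicaExchangeModeTorpid
import Summits.Ventures.LatticeQCDFlow.Scaling.ReplicaExchangeBareSampler

/-!
HONEST FRAMING: exact (Metropolis-corrected) sampling algorithms for lattice gauge theory; figures
of merit are autocorrelation/cost numbers at stated couplings and volumes; no continuum-physics
claim.

# ExchangeSchemeCutCeiling — THE WEAKEST LINK: FOR `P = t·Q + (1−t)·Upd_w` AND ANY CUT OF THE LADDER BELOW LEVEL
# `j`, `Gap(P)·Σ_{k>j} μ_k(A)μ_k(Aᶜ) ≤ t·𝓔_Q(N_A^{>j}) + (1−t)·Σ_{k>j} w_k Q_k(A,Aᶜ)` (`N_A^{>j}` = THE NUMBER OF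
# REPLICAS BELOW THE CUT SITTING IN SECTOR `A`); WITH SECTOR-FROZEN COLD REPLICAS `Gap(P) ≤ t·𝓔_Q(N_A^{>j})/((K−j)v)`,
# AND FOR THE METROPOLIS LADDER `𝓔_{Sw}(N_A^{>j}) ≤ α_j/(2K)`: ONE POORLY OVERLAPPING ADJACENT PAIR (`α_j` SMALL)
# THROTTLES EVERY REPLICA BELOW IT — `Gap(ptBareSampler) ≤ t·α_j/(2K(K−j)v)` (lean-2 GEN-20, ours)

Venture-side (OURS).  Cell `lqcd-flow` (pub-lqcd), unit `pub-lqcd-lean-2-g20`, 2026-08-25.  Chapter H (universal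
ceilings); the cut `j = 0` is the handover ceiling of `ExchangeSchemeHandoverCeiling`.  State space `Fin (K+1) → S`
(`S` finite), law `π̃ = ⊗_k μ_k` (`tensorFun μ`), replica updates `Upd_w = prodKernel w M` (weights `w`, `M_k`
row-stochastic `μ_k`-reversible), an exchange move `Q` (row-stochastic, `π̃`-reversible — NOTHING ELSE is asked of `Q`
in §2), `P(x,y) = t·Q(x,y) + (1−t)·Upd_w(x,y)`.  For a cut `j < K` the test function is the centred count below the
cut, `G_j(x) = Σ_{k : j<k} f_A^{(μ_k)}(x_k)` (`f_A^{(ν)} = 1_{Aᶜ} − ν(Aᶜ)` = `bottleneckTestFun ν A`);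
`Q_k(A,Aᶜ) = edgeMeasure (μ k) (M k) A Aᶜ`; `α_j = ptFinAcc μ j = Σ_x min{π̃(x), π̃(x∘σ_j)}` is the stationary
acceptance of the swap of levels `j, j+1`.

## What is proved

* §1 `G_j`: coordinate means, `tensorFun_mean_cutCount`, `tensorFun_piInner_cutCount` (`Σ_{k>j} μ_k(A)μ_k(Aᶜ)`),
  `prodKernel_dirichletForm_cutCount` (`Σ_{k>j} w_kQ_k(A,Aᶜ)`), `cutCount_sub_eq`, `cutMass_ge` (`≥ (K−j)v`).
* §2 **`cut_spectralGap_le`**: `Gap(P) ≤ (t·𝓔_Q(G_j) + (1−t)Σ_{k>j} w_kQ_k(A,Aᶜ))/Σ_{k>j} μ_k(A)μ_k(Aᶜ)` (`0 ≤ t ≤ 1`,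
  `w` a probability vector, `|S| ≥ 2`); **`cutFrozen_spectralGap_le`**: replicas below the cut sector-frozen
  (`Q_k(A,Aᶜ) = 0`, `μ_k(A)μ_k(Aᶜ) ≥ v > 0` for `k > j`) ⇒ `Gap(P) ≤ t·𝓔_Q(G_j)/((K−j)·v)`;
  `exchange_dirichletForm_cutCount_le` (a move changing the count below the cut by at most one:
  `𝓔_Q(G_j) ≤ ½·Σ_x π̃(x)·Q(x, {count below the cut changes})`).
* §3 THE METROPOLIS LADDER (`Q = ptBareSwap μ`): only the swap of levels `j, j+1` moves a label across the cut, so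
  **`ptBareSwap_dirichletForm_cutCount_le`: `𝓔_{Sw}(G_j) ≤ α_j/(2K)`** and **`ptBareCut_spectralGap_le`:
  `Gap(ptBareSampler t μ M) ≤ t·α_j/(2K(K−j)v)`** for every cut above sector-frozen replicas.

Reading (no numerics implied): sector information crosses a cut of the ladder only with an accepted exchange across
it; everything below the cut waits.  A single adjacent pair of couplings with poor overlap (`α_j` small — too few
replicas over that stretch of the action, cf. `ReplicaExchangeBareAcceptance`) caps the relaxation of the `K − j`
colder replicas at `t·α_j/(2K(K−j)v)` per step, however good the rest of the ladder and the hot sampler are.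
NOT CLAIMED: floors; continuous configuration spaces; anything measured.  Literature grade (cell rule): KNOWN
MECHANISM (test-function ceilings), NEW TYPING (per-cut form with the acceptance); nothing cited as a fact; no new
bib keys.
-/

noncomputable section

open Finset Function
open Literature.Probability.MarkovChains

namespace Summit.Ventures.LatticeQCDFlow.Scaling

variable {S : Type*} [Fintype S] [DecidableEq S] {K : ℕ} {μ : Fin (K + 1) → S → ℝ}
  {M : Fin (K + 1) → S → S → ℝ} {w : Fin (K + 1) → ℝ} {t : ℝ} {j : ℕ}
  {Q : Matrix (Fin (K + 1) → S) (Fin (K + 1) → S) ℝ}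

/-! ## §1 The centred count below a cut -/

/-- Coordinate means of the cut count vanish. [ours] -/
theorem sum_mul_cutCount_coord (A : Finset S) (j : ℕ) (k : Fin (K + 1)) :
    ∑ u, μ k u * (if j < (k : ℕ) then bottleneckTestFun (μ k) A u else 0) = 0 := by
  by_cases hk : j < (k : ℕ) <;> simp [hk, sum_mul_bottleneckTestFun]

omit [DecidableEq S] in
/-- **The cut count is centred under `π̃`.** [ours] -/
theorem tensorFun_mean_cutCount [DecidableEq S] (hμ1 : ∀ k, ∑ u, μ k u = 1) (A : Finset S) (j : ℕ) :
    ∑ x : Fin (K + 1) → S, tensorFun μ x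
        * ∑ k : Fin (K + 1), (if j < (k : ℕ) then bottleneckTestFun (μ k) A (x k) else 0) = 0 := by
  rw [sum_tensorFun_mul_additive μ hμ1 (fun k u => if j < (k : ℕ) then bottleneckTestFun (μ k) A u else 0)]
  exact Finset.sum_eq_zero fun k _ => sum_mul_cutCount_coord A j k

/-- **`‖G_j‖²_π̃ = Σ_{k>j} μ_k(A)μ_k(Aᶜ)`.** [ours] -/
theorem tensorFun_piInner_cutCount (hμ1 : ∀ k, ∑ u, μ k u = 1) (A : Finset S) (j : ℕ) :
    piInner (tensorFun μ) (fun x => ∑ k : Fin (K + 1), (if j < (k : ℕ) then bottleneckTestFun (μ k) A (x k) else 0))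
        (fun x => ∑ k : Fin (K + 1), (if j < (k : ℕ) then bottleneckTestFun (μ k) A (x k) else 0))
      = ∑ k : Fin (K + 1), (if j < (k : ℕ) then (∑ u ∈ A, μ k u) * ∑ u ∈ Aᶜ, μ k u else 0) := by
  rw [piInner_tensorFun_additive μ hμ1 (fun k u => if j < (k : ℕ) then bottleneckTestFun (μ k) A u else 0)
    (fun k => sum_mul_cutCount_coord A j k)]
  refine sum_congr rfl fun k _ => ?_
  by_cases hk : j < (k : ℕ)
  · simp only [hk, if_true]; exact piInner_bottleneckTestFun (hμ1 k) A
  · simp [hk, piInner]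

/-- **`𝓔_{Upd_w}(G_j) = Σ_{k>j} w_k·Q_k(A,Aᶜ)`.** [ours] -/
theorem prodKernel_dirichletForm_cutCount (hμ1 : ∀ k, ∑ u, μ k u = 1) (hM : ∀ k, IsRowStochastic (M k))
    (hMrev : ∀ k, DetailedBalance (μ k) (M k)) (w : Fin (K + 1) → ℝ) (A : Finset S) (j : ℕ) :
    dirichletForm (tensorFun μ) (prodKernel w M)
        (fun x => ∑ k : Fin (K + 1), (if j < (k : ℕ) then bottleneckTestFun (μ k) A (x k) else 0))
      = ∑ k : Fin (K + 1), w k * (if j < (k : ℕ) then edgeMeasure (μ k) (M k) A Aᶜ else 0) := by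
  rw [dirichletForm_prodKernel_additive μ hμ1 w M
    (fun k u => if j < (k : ℕ) then bottleneckTestFun (μ k) A u else 0)]
  refine sum_congr rfl fun k _ => ?_
  by_cases hk : j < (k : ℕ)
  · simp only [hk, if_true]; rw [dirichletForm_bottleneckTestFun (hM k) ((hMrev k).isStationary (hM k).2) (hμ1 k) A]
  · simp [hk, dirichletForm]

omit [Fintype S] in
/-- **Increments of the cut count:** `G_j(x) − G_j(y) = Σ_{k>j} (1_A(y_k) − 1_A(x_k))`. [ours] -/
theorem cutCount_sub_eq [Fintype S] (hμ1 : ∀ k, ∑ u, μ k u = 1) (A : Finset S) (j : ℕ) (x y : Fin (K + 1) → S) :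
    (∑ k : Fin (K + 1), (if j < (k : ℕ) then bottleneckTestFun (μ k) A (x k) else 0))
        - ∑ k : Fin (K + 1), (if j < (k : ℕ) then bottleneckTestFun (μ k) A (y k) else 0)
      = ∑ k : Fin (K + 1), (if j < (k : ℕ) then ((if y k ∈ A then (1 : ℝ) else 0) - (if x k ∈ A then (1 : ℝ) else 0))
          else 0) := by
  rw [← Finset.sum_sub_distrib]
  refine sum_congr rfl fun k _ => ?_
  by_cases hk : j < (k : ℕ)
  · simp only [hk, if_true]
    rw [bottleneckTestFun_eq (hμ1 k), bottleneckTestFun_eq (hμ1 k)]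
    split_ifs <;> ring
  · simp [hk]

omit [DecidableEq S] in
/-- `Σ_{k>j} μ_k(A)μ_k(Aᶜ) ≥ (K − j)·v` when every level below the cut has `μ_k(A)μ_k(Aᶜ) ≥ v` (`j < K`). [ours] -/
theorem cutMass_ge [DecidableEq S] (hj : j < K) {A : Finset S} {v : ℝ}
    (hv : ∀ k : Fin (K + 1), j < (k : ℕ) → v ≤ (∑ u ∈ A, μ k u) * ∑ u ∈ Aᶜ, μ k u) :
    ((K : ℝ) - j) * v ≤ ∑ k : Fin (K + 1), (if j < (k : ℕ) then (∑ u ∈ A, μ k u) * ∑ u ∈ Aᶜ, μ k u else 0) := by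
  -- the levels `j+1, …, K` are `K − j` of the `K+1` levels
  have hcard : ((univ : Finset (Fin (K + 1))).filter (fun k : Fin (K + 1) => j < (k : ℕ))).card = K - j := by
    have e : (univ : Finset (Fin (K + 1))).filter (fun k : Fin (K + 1) => j < (k : ℕ))
        = Finset.Ioi (⟨j, by omega⟩ : Fin (K + 1)) := by
      ext k; simp [Fin.lt_def]
    rw [e, Fin.card_Ioi]
    dsimp only
    omega
  rw [← Finset.sum_filter]
  calc ((K : ℝ) - j) * v = ∑ _k ∈ (univ : Finset (Fin (K + 1))).filter (fun k : Fin (K + 1) => j < (k : ℕ)), v := by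
        rw [Finset.sum_const, hcard, nsmul_eq_mul, Nat.cast_sub hj.le]
    _ ≤ _ := sum_le_sum fun k hk => hv k (mem_filter.mp hk).2

/-! ## §2 The cut ceiling for any exchange scheme -/

section Ceiling

variable [Nontrivial S] (hμ : ∀ k x, 0 < μ k x) (hμ1 : ∀ k, ∑ u, μ k u = 1) (hM : ∀ k, IsRowStochastic (M k))
  (hMrev : ∀ k, DetailedBalance (μ k) (M k)) (hw0 : ∀ k, 0 ≤ w k) (hw1 : ∑ k, w k = 1) (ht0 : 0 ≤ t) (ht1 : t ≤ 1)
  (hQ : IsRowStochastic Q) (hQrev : DetailedBalance (tensorFun μ) Q)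
include hμ hμ1 hM hMrev hw0 hw1 ht0 ht1 hQ hQrev

/-- **THE CUT CEILING:** for every row-stochastic `π̃`-reversible exchange move `Q`, every cut `j`, and
`Σ_{k>j} μ_k(A)μ_k(Aᶜ) > 0`: `Gap(P) ≤ (t·𝓔_Q(G_j) + (1−t)·Σ_{k>j} w_k·Q_k(A,Aᶜ))/Σ_{k>j} μ_k(A)μ_k(Aᶜ)`. [ours] -/
theorem cut_spectralGap_le (A : Finset S) (j : ℕ)
    (hA : 0 < ∑ k : Fin (K + 1), (if j < (k : ℕ) then (∑ u ∈ A, μ k u) * ∑ u ∈ Aᶜ, μ k u else 0)) :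
    spectralGap (tensorFun μ) (fun x y : Fin (K + 1) → S => t * Q x y + (1 - t) * prodKernel w M x y)
      ≤ (t * dirichletForm (tensorFun μ) Q (fun x => ∑ k : Fin (K + 1), (if j < (k : ℕ) then bottleneckTestFun (μ k) A (x k) else 0))
          + (1 - t) * ∑ k : Fin (K + 1), w k * (if j < (k : ℕ) then edgeMeasure (μ k) (M k) A Aᶜ else 0))
        / ∑ k : Fin (K + 1), (if j < (k : ℕ) then (∑ u ∈ A, μ k u) * ∑ u ∈ Aᶜ, μ k u else 0) := by
  have hU := prodKernel_isRowStochastic M w hw0 hw1 hM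
  have hP : IsRowStochastic (fun x y : Fin (K + 1) → S => t * Q x y + (1 - t) * prodKernel w M x y) := by
    refine ⟨fun x y => add_nonneg (mul_nonneg ht0 (hQ.1 x y)) (mul_nonneg (by linarith) (hU.1 x y)), fun x => ?_⟩
    simp only
    rw [Finset.sum_add_distrib, ← Finset.mul_sum, ← Finset.mul_sum, hQ.2 x, hU.2 x]; ring
  have hDB : DetailedBalance (tensorFun μ) (fun x y : Fin (K + 1) → S => t * Q x y + (1 - t) * prodKernel w M x y) := by
    intro x y
    have h1 := hQrev x y
    have h2 := prodKernel_detailedBalance (π := μ) hMrev w x y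
    simp only
    linear_combination t * h1 + (1 - t) * h2
  set G : (Fin (K + 1) → S) → ℝ := fun x => ∑ k : Fin (K + 1), (if j < (k : ℕ) then bottleneckTestFun (μ k) A (x k) else 0) with hG
  have hsplit : dirichletForm (tensorFun μ) (fun x y : Fin (K + 1) → S => t * Q x y + (1 - t) * prodKernel w M x y) G
      = t * dirichletForm (tensorFun μ) Q G + (1 - t) * dirichletForm (tensorFun μ) (prodKernel w M) G := by
    unfold dirichletForm
    rw [← mul_assoc, ← mul_assoc, mul_comm t, mul_comm (1 - t), mul_assoc, mul_assoc, ← mul_add]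
    congr 1
    rw [Finset.mul_sum, Finset.mul_sum, ← Finset.sum_add_distrib]
    refine sum_congr rfl fun x _ => ?_
    rw [Finset.mul_sum, Finset.mul_sum, ← Finset.sum_add_distrib]
    exact sum_congr rfl fun y _ => by ring
  have hray := LevinPeres2017_lemma_13_7_rayleigh (tensorFun_pos hμ) (sum_tensorFun_eq_one μ hμ1) hP hDB
    (tensorFun_mean_cutCount (μ := μ) hμ1 A j)
  rw [tensorFun_piInner_cutCount hμ1, hsplit, prodKernel_dirichletForm_cutCount hμ1 hM hMrev] at hray
  rw [le_div_iff₀ hA]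
  exact hray

/-- **SECTOR-FROZEN REPLICAS BELOW THE CUT: `Gap(P) ≤ t·𝓔_Q(G_j)/((K − j)·v)`** (`j < K`; `Q_k(A,Aᶜ) = 0` and
`μ_k(A)μ_k(Aᶜ) ≥ v > 0` for `k > j`) — everything below the cut waits for exchanges across it. [ours] -/
theorem cutFrozen_spectralGap_le (hj : j < K) {A : Finset S} {v : ℝ} (hvpos : 0 < v)
    (hv : ∀ k : Fin (K + 1), j < (k : ℕ) → v ≤ (∑ u ∈ A, μ k u) * ∑ u ∈ Aᶜ, μ k u)
    (hfrozen : ∀ k : Fin (K + 1), j < (k : ℕ) → edgeMeasure (μ k) (M k) A Aᶜ = 0) :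
    spectralGap (tensorFun μ) (fun x y : Fin (K + 1) → S => t * Q x y + (1 - t) * prodKernel w M x y)
      ≤ t * dirichletForm (tensorFun μ) Q (fun x => ∑ k : Fin (K + 1), (if j < (k : ℕ) then bottleneckTestFun (μ k) A (x k) else 0))
          / (((K : ℝ) - j) * v) := by
  have hKj : (0 : ℝ) < (K : ℝ) - j := by
    have : (j : ℝ) < K := by exact_mod_cast hj
    linarith
  have hVge := cutMass_ge (μ := μ) hj hv
  have h := cut_spectralGap_le hμ hμ1 hM hMrev hw0 hw1 ht0 ht1 hQ hQrev A j (lt_of_lt_of_le (mul_pos hKj hvpos) hVge)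
  have hU0 : ∑ k : Fin (K + 1), w k * (if j < (k : ℕ) then edgeMeasure (μ k) (M k) A Aᶜ else 0) = 0 :=
    Finset.sum_eq_zero fun k _ => by by_cases hk : j < (k : ℕ) <;> simp [hk, hfrozen]
  rw [hU0, mul_zero, add_zero] at h
  have hE0 : 0 ≤ t * dirichletForm (tensorFun μ) Q
      (fun x => ∑ k : Fin (K + 1), (if j < (k : ℕ) then bottleneckTestFun (μ k) A (x k) else 0)) :=
    mul_nonneg ht0 (dirichletForm_nonneg (fun x => (tensorFun_pos hμ x).le) hQ.1 _)
  exact h.trans (div_le_div_of_nonneg_left hE0 (mul_pos hKj hvpos) hVge)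

end Ceiling

/-- **One label across the cut per move:** if `Q(x,y) ≠ 0` implies that the number of `A`-labels below the cut
changes by at most one, then `𝓔_Q(G_j) ≤ ½·Σ_x π̃(x)·Σ_{y : the count changes} Q(x,y)` (`π̃, Q ≥ 0`). [ours] -/
theorem exchange_dirichletForm_cutCount_le (hμ : ∀ k x, 0 < μ k x) (hμ1 : ∀ k, ∑ u, μ k u = 1)
    (hQ : IsRowStochastic Q) (A : Finset S) (j : ℕ)
    (hQj : ∀ x y, Q x y ≠ 0 → (∑ k : Fin (K + 1), (if j < (k : ℕ) then
        ((if y k ∈ A then (1 : ℝ) else 0) - (if x k ∈ A then (1 : ℝ) else 0)) else 0)) ^ 2 ≤ 1) :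
    dirichletForm (tensorFun μ) Q (fun x => ∑ k : Fin (K + 1), (if j < (k : ℕ) then bottleneckTestFun (μ k) A (x k) else 0))
      ≤ 1 / 2 * ∑ x, tensorFun μ x * ∑ y ∈ univ.filter (fun y => (∑ k : Fin (K + 1), (if j < (k : ℕ) then
          ((if y k ∈ A then (1 : ℝ) else 0) - (if x k ∈ A then (1 : ℝ) else 0)) else 0)) ≠ 0), Q x y := by
  unfold dirichletForm
  apply mul_le_mul_of_nonneg_left ?_ (by norm_num : (0 : ℝ) ≤ 1 / 2)
  refine sum_le_sum fun x _ => ?_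
  rw [Finset.mul_sum, Finset.sum_filter]
  refine sum_le_sum fun y _ => ?_
  rw [cutCount_sub_eq hμ1 A j x y]
  by_cases hq : Q x y = 0
  · rw [hq]; simp
  · split_ifs with hne
    · rw [mul_assoc]
      refine mul_le_mul_of_nonneg_left ?_ (tensorFun_pos hμ x).le
      calc Q x y * _ ≤ Q x y * 1 := mul_le_mul_of_nonneg_left (hQj x y hq) (hQ.1 x y)
        _ = Q x y := mul_one _
    · rw [not_not.mp hne]; simp

/-! ## §3 The Metropolis ladder: one poorly overlapping pair throttles everything below it -/

omit [Fintype S] in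
/-- A swap of levels `i, i+1` with `i ≠ j` does not change the count below the cut `j`; the swap of levels `j, j+1`
changes it by `1_A(x_j) − 1_A(x_{j+1})`. [ours] -/
theorem cutCount_indicator_sub_swap (A : Finset S) (j : ℕ) (i : Fin K) (x : Fin (K + 1) → S) :
    (∑ k : Fin (K + 1), (if j < (k : ℕ) then
        ((if (x ∘ levelSwap i) k ∈ A then (1 : ℝ) else 0) - (if x k ∈ A then (1 : ℝ) else 0)) else 0))
      = if (i : ℕ) = j then ((if x i.castSucc ∈ A then (1 : ℝ) else 0) - (if x i.succ ∈ A then (1 : ℝ) else 0))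
        else 0 := by
  -- only the levels `i.castSucc`, `i.succ` can contribute
  have hterm : ∀ k : Fin (K + 1), k ≠ i.castSucc → k ≠ i.succ →
      (if j < (k : ℕ) then ((if (x ∘ levelSwap i) k ∈ A then (1 : ℝ) else 0) - (if x k ∈ A then (1 : ℝ) else 0))
        else 0) = 0 := by
    intro k hk1 hk2
    have : (x ∘ levelSwap i) k = x k := by
      simp only [comp_apply, levelSwap, Equiv.swap_apply_of_ne_of_ne hk1 hk2]
    rw [this, sub_self]; simp
  have hne : i.castSucc ≠ i.succ := fun h => by
    have := congrArg Fin.val h; simp [Fin.val_succ] at this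
  rw [← Finset.sum_subset (subset_univ ({i.castSucc, i.succ} : Finset (Fin (K + 1))))
    (fun k _ hk => hterm k (by rintro rfl; simp at hk) (by rintro rfl; simp at hk)),
    Finset.sum_pair hne]
  have e1 : (x ∘ levelSwap i) i.castSucc = x i.succ := by simp [levelSwap]
  have e2 : (x ∘ levelSwap i) i.succ = x i.castSucc := by simp [levelSwap]
  rw [e1, e2]
  have hcs : ((i.castSucc : Fin (K + 1)) : ℕ) = i := rfl
  have hsc : ((i.succ : Fin (K + 1)) : ℕ) = i + 1 := rfl
  have c1 : (j < ((i.castSucc : Fin (K + 1)) : ℕ)) ↔ j < (i : ℕ) := by rw [hcs]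
  have c2 : (j < ((i.succ : Fin (K + 1)) : ℕ)) ↔ j < (i : ℕ) + 1 := by rw [hsc]
  by_cases hij : (i : ℕ) = j
  · rw [if_neg (c1.not.mpr (by omega)), if_pos (c2.mpr (by omega)), if_pos hij]; ring
  · rw [if_neg hij]
    by_cases h1 : j < (i : ℕ)
    · rw [if_pos (c1.mpr h1), if_pos (c2.mpr (by omega))]; ring
    · rw [if_neg (c1.not.mpr h1), if_neg (c2.not.mpr (by omega))]; ring

section Ladder

variable (hμ : ∀ k x, 0 < μ k x) (hμ1 : ∀ k, ∑ u, μ k u = 1)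
include hμ hμ1

/-- **`𝓔_{Sw}(G_j) ≤ α_j/(2K)`:** under the Metropolis swap move only the swap of levels `j, j+1` moves a label
across the cut, with flow `min{π̃(x), π̃(x∘σ_j)}/K`, and the squared increment is at most one. [ours] -/
theorem ptBareSwap_dirichletForm_cutCount_le (A : Finset S) (j : Fin K) :
    dirichletForm (tensorFun μ) (ptBareSwap μ)
        (fun x => ∑ k : Fin (K + 1), (if (j : ℕ) < (k : ℕ) then bottleneckTestFun (μ k) A (x k) else 0))
      ≤ ptFinAcc μ j / (2 * K) := by
  have hKpos : (0 : ℝ) < K := Nat.cast_pos.mpr (Fin.pos j)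
  set G : (Fin (K + 1) → S) → ℝ := fun x => ∑ k : Fin (K + 1), (if (j : ℕ) < (k : ℕ) then bottleneckTestFun (μ k) A (x k) else 0)
    with hG
  -- pointwise: `π̃(x)Sw(x,y)(ΔG)² ≤ Σ_i [y = x∘σ_i]/K · min{π̃ x, π̃ y}(ΔG)²`
  have hpt : ∀ x y : Fin (K + 1) → S, tensorFun μ x * ptBareSwap μ x y * (G x - G y) ^ 2
      ≤ ptBareProposal x y * (min (tensorFun μ x) (tensorFun μ y) * (G x - G y) ^ 2) := by
    intro x y
    by_cases hyx : y = x
    · rw [hyx, sub_self]; simp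
    · rw [tensorFun_mul_ptBareSwap hμ hyx, mul_assoc]
  have hrow : ∀ (x : Fin (K + 1) → S) (c : (Fin (K + 1) → S) → ℝ),
      ∑ y, ptBareProposal x y * c y = ∑ i : Fin K, 1 / K * c (x ∘ levelSwap i) := by
    intro x c
    unfold ptBareProposal
    simp_rw [Finset.sum_mul]
    rw [Finset.sum_comm]
    refine sum_congr rfl fun i _ => ?_
    simp_rw [ite_mul, zero_mul]
    rw [Finset.sum_ite_eq' univ (x ∘ levelSwap i), if_pos (mem_univ _)]
  -- the increment along `σ_i`
  have hΔ : ∀ (x : Fin (K + 1) → S) (i : Fin K), (G x - G (x ∘ levelSwap i)) ^ 2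
      = if (i : ℕ) = (j : ℕ) then ((if x i.castSucc ∈ A then (1 : ℝ) else 0) - (if x i.succ ∈ A then (1 : ℝ) else 0)) ^ 2
        else 0 := by
    intro x i
    rw [hG, cutCount_sub_eq hμ1 A j x (x ∘ levelSwap i), cutCount_indicator_sub_swap A j i x]
    split_ifs <;> simp
  unfold dirichletForm
  calc 1 / 2 * ∑ x, ∑ y, tensorFun μ x * ptBareSwap μ x y * (G x - G y) ^ 2
      ≤ 1 / 2 * ∑ x, ∑ y, ptBareProposal x y * (min (tensorFun μ x) (tensorFun μ y) * (G x - G y) ^ 2) :=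
        mul_le_mul_of_nonneg_left (sum_le_sum fun x _ => sum_le_sum fun y _ => hpt x y) (by norm_num)
    _ = 1 / 2 * ∑ x, ∑ i : Fin K, 1 / K * (min (tensorFun μ x) (tensorFun μ (x ∘ levelSwap i))
          * (G x - G (x ∘ levelSwap i)) ^ 2) := by
        congr 1
        exact sum_congr rfl fun x _ => hrow x (fun y => min (tensorFun μ x) (tensorFun μ y) * (G x - G y) ^ 2)
    _ = 1 / 2 * ∑ x, 1 / K * (min (tensorFun μ x) (tensorFun μ (x ∘ levelSwap j))
          * ((if x j.castSucc ∈ A then (1 : ℝ) else 0) - (if x j.succ ∈ A then (1 : ℝ) else 0)) ^ 2) := by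
        congr 1
        refine sum_congr rfl fun x _ => ?_
        simp_rw [hΔ x]
        rw [Finset.sum_eq_single j (fun i _ hi => by rw [if_neg (fun h => hi (Fin.ext h))]; ring)
          (fun h => absurd (mem_univ _) h), if_pos rfl]
    _ ≤ 1 / 2 * ∑ x, 1 / K * min (tensorFun μ x) (tensorFun μ (x ∘ levelSwap j)) := by
        refine mul_le_mul_of_nonneg_left (sum_le_sum fun x _ => ?_) (by norm_num)
        refine mul_le_mul_of_nonneg_left ?_ (by positivity)
        have hmin : 0 ≤ min (tensorFun μ x) (tensorFun μ (x ∘ levelSwap j)) :=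
          le_min (tensorFun_pos hμ _).le (tensorFun_pos hμ _).le
        have hsq : ((if x j.castSucc ∈ A then (1 : ℝ) else 0) - (if x j.succ ∈ A then (1 : ℝ) else 0)) ^ 2 ≤ 1 := by
          split_ifs <;> norm_num
        calc _ ≤ min (tensorFun μ x) (tensorFun μ (x ∘ levelSwap j)) * 1 := mul_le_mul_of_nonneg_left hsq hmin
          _ = _ := mul_one _
    _ = ptFinAcc μ j / (2 * K) := by
        unfold ptFinAcc
        rw [← Finset.mul_sum, ← mul_assoc]
        field_simp

/-- **ONE POORLY OVERLAPPING PAIR THROTTLES EVERYTHING BELOW IT:** for the tagless Metropolis ladder with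
sector-frozen replicas below the cut `j` (`Q_k(A,Aᶜ) = 0`, `μ_k(A)μ_k(Aᶜ) ≥ v > 0` for `k > j`), `0 ≤ t ≤ 1`,
`|S| ≥ 2`: `Gap(ptBareSampler t μ M) ≤ t·α_j/(2K·(K − j)·v)`. [ours] -/
theorem ptBareCut_spectralGap_le [Nontrivial S] (hM : ∀ k, IsRowStochastic (M k))
    (hMrev : ∀ k, DetailedBalance (μ k) (M k)) (ht0 : 0 ≤ t) (ht1 : t ≤ 1) (j : Fin K) {A : Finset S} {v : ℝ}
    (hvpos : 0 < v) (hv : ∀ k : Fin (K + 1), (j : ℕ) < (k : ℕ) → v ≤ (∑ u ∈ A, μ k u) * ∑ u ∈ Aᶜ, μ k u)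
    (hfrozen : ∀ k : Fin (K + 1), (j : ℕ) < (k : ℕ) → edgeMeasure (μ k) (M k) A Aᶜ = 0) :
    spectralGap (tensorFun μ) (ptBareSampler t μ M) ≤ t * ptFinAcc μ j / (2 * K * (((K : ℝ) - j) * v)) := by
  have hKpos : (0 : ℝ) < K := Nat.cast_pos.mpr (Fin.pos j)
  have hKj : (0 : ℝ) < (K : ℝ) - j := by
    have : ((j : ℕ) : ℝ) < K := by exact_mod_cast j.isLt
    linarith
  have h := cutFrozen_spectralGap_le (Q := ptBareSwap μ) (w := fun _ : Fin (K + 1) => (1 : ℝ) / (K + 1)) hμ hμ1 hM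
    hMrev (fun _ => by positivity) (sum_uniform_weight K) ht0 ht1 (ptBareSwap_isRowStochastic hμ)
    (ptBareSwap_detailedBalance hμ) j.isLt hvpos hv hfrozen
  have hE := ptBareSwap_dirichletForm_cutCount_le hμ hμ1 A j
  calc spectralGap (tensorFun μ) (ptBareSampler t μ M)
      = spectralGap (tensorFun μ)
          (fun x y : Fin (K + 1) → S => t * ptBareSwap μ x y + (1 - t) * prodKernel (fun _ => (1 : ℝ) / (K + 1)) M x y) :=
        rfl
    _ ≤ _ := h
    _ ≤ t * (ptFinAcc μ j / (2 * K)) / (((K : ℝ) - j) * v) :=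
        div_le_div_of_nonneg_right (mul_le_mul_of_nonneg_left hE ht0) (by positivity)
    _ = t * ptFinAcc μ j / (2 * K * (((K : ℝ) - j) * v)) := by
        field_simp

end Ladder

end Summit.Ventures.LatticeQCDFlow.Scaling

end
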